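import Literature.Analysis.FluidPDE.KNSSRegularity
import Literature.Analysis.FluidPDE.DriftHeatComparison
import Literature.Analysis.FluidPDE.DriftHeatBarrier
import HarnessLib

/-!
# KNSS 2009, Lemma 2.1 (stability of the strong maximum principle), half-ball form: proof

Analysis/FluidPDE proofs file discharging the named fact
`Literature.Analysis.FluidPDE.KNSS2009_lemma21_halfball` (`FluidPDE/KNSSRegularity`; Koch–Nadirashvili–
Seregin–Šverák, *Liouville theorems for the Navier–Stokes equations and applications*, Acta
Math. 203 (2009) = arXiv:0709.3599, Lemma 2.1 p. 5, in the form used in the proofs of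
Theorems 5.1–5.2, pp. 9–10: a bounded solution of `fₜ + a·∇f − Δf = 0` on `E × (−∞, 0)` with
bounded measurable drift and `sup f = M₁ > 0` is `≥ M₁/2` on parabolic balls
`B(ȳ, R) × (t̄ − R², t̄)` of every radius) by
`Literature.Analysis.FluidPDE.KNSS2009_lemma21_halfball_holds`.

## Proof

KNSS prove Lemma 2.1 by contradiction and compactness: weak-* limits of the drifts, locally
uniform limits of the solutions (the `W^{2,1}_p` regularity of [LSU]), and the strong maximum
principle for the limit equation — none of which is available in Mathlib. For the elementary
solution class of the vendored fact (`C²` slices, bounded and jointly continuous `∇f`, `Δf`,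
time-integrated equation) we give instead a direct quantitative proof, by **propagation of
positivity** for `v = M₁ − f ≥ 0` (which solves the same equation, `inf v = 0` approached):

* `driftHeat_propagation` (a variant of Lieberman 1996, Ch. II, Lemma 2.6): there is
  `ε₀ = ε₀(M₁, R, C, A, dim E) > 0` such that `v(t₁, y₁) > M₁/2` at some `t₁ < 0` forces
  `v ≥ ε₀` on `B(y₁, R) × [t₁ + 1, t₁ + 1 + R²]`. Indeed `v(t₁, ·) ≥ M₁/4` on `B(y₁, r₀)`,
  `r₀ = M₁/(4(C + 1))`, by the gradient bound `‖∇v‖ ≤ C`; the expanding-ball barrier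
  `φ(t, y) = (M₁/4) e^{−l(t − t₁)} (1 − ‖y − y₁‖²/ρ(t)²)^(n+2)`, `ρ(t) = r₀ + 2R (t − t₁)`
  (`FluidPDE/DriftHeatBarrier`, `knssBarrier_subsolution`: `φ_t − Δφ + A‖∇φ‖ ≤ 0` for suitable
  `l, n`) lies below `v` at `t = t₁` and vanishes on `‖y − y₁‖ = ρ(t)`, so the comparison
  principle (`FluidPDE/DriftHeatComparison`, `driftHeat_comparison`) gives `v ≥ φ` on
  `‖y − y₁‖ ≤ ρ(t)`, `t₁ ≤ t < 0`; and `φ ≥ ε₀ := (M₁/4) e^{−l(1 + R²)} (3/4)^(n+2)` for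
  `t − t₁ ∈ [1, 1 + R²]`, `‖y − y₁‖ < R ≤ ρ(t)/2`.
* `KNSS2009_lemma21_halfball_holds`: if some radius `R` admitted no good parabolic ball, every
  `B(y*, R) × (t* − 1 − R², t* − 1)` would contain a point with `f < M₁/2`, i.e. `v > M₁/2`,
  whence `v(t*, y*) ≥ ε₀` for *all* `t* < 0`, `y*`: `f ≤ M₁ − ε₀`, contradicting `sup f = M₁`.

## References

* G. Koch, N. Nadirashvili, G. Seregin, V. Šverák, *Liouville theorems for the Navier–Stokes
  equations and applications*, Acta Math. 203 (2009) 83–105 = arXiv:0709.3599: Lemma 2.1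
  (p. 5) and its use in the proofs of Theorems 5.1–5.2 (pp. 9–10)
  [KochNadirashviliSereginSverak2009].
* G. M. Lieberman, *Second order parabolic differential equations*, World Scientific 1996,
  Ch. II, Lemma 2.6 (propagation of positivity by an expanding-paraboloid barrier) and
  Cor. 2.5 (comparison principle) [Lieberman1996].
-/

noncomputable section

open MeasureTheory Set Function Filter Topology InnerProductSpace Metric
open scoped RealInnerProductSpace Laplacian ContDiff

namespace Literature.Analysis.FluidPDE

/-! ### Propagation of positivity and the half-ball form of KNSS Lemma 2.1 -/

section Propagation

variable {E : Type*} [NormedAddCommGroup E] [InnerProductSpace ℝ E] [FiniteDimensional ℝ E]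
  [MeasurableSpace E] [BorelSpace E]

/-- **Propagation of positivity for the drift–heat class** (a variant of Lieberman 1996, Ch. II,
Lemma 2.6, for `v_t + a·∇v − Δv = 0` with an arbitrary measurable drift `‖a‖ ≤ A` on
`E × (−∞, 0)`): for a nonnegative solution `v` in the class of `driftHeat_comparison` with
`‖∇v‖ ≤ C`, and `μ, R > 0`, there is `ε₀ = ε₀(μ, R, C, A, dim E) > 0` such that `v(t₁, y₁) > μ`
at some `t₁ < 0` forces `v ≥ ε₀` on `B(y₁, R) × [t₁ + 1, t₁ + 1 + R²]` (times `< 0`). Proof: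
`v(t₁, ·) ≥ μ/2` on `B(y₁, r₀)`, `r₀ = μ/(2(C+1))`, by the gradient bound; then compare with the
expanding-ball barrier `knssBarrier y₁ (μ/2) l r₀ (2R) t₁ n` (`knssBarrier_subsolution`,
`driftHeat_comparison`), whose radius exceeds `2R` after time `1`. [cite: Lieberman1996, Ch. II Lemma 2.6 (variant)] -/
theorem driftHeat_propagation {v : ℝ → E → ℝ} {a : ℝ → E → E} {A C μ R : ℝ}
    (ha_meas : Measurable (uncurry a)) (ha : ∀ t < 0, ∀ y, ‖a t y‖ ≤ A)
    (hv2 : ∀ t < 0, ContDiff ℝ 2 (v t))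
    (hbd : ∀ t < 0, ∀ y, ‖fderiv ℝ (v t) y‖ ≤ C ∧ |(Δ (v t)) y| ≤ C)
    (hcD : ContinuousOn (fun p : ℝ × E => fderiv ℝ (v p.1) p.2) (Iio 0 ×ˢ univ))
    (hcΔ : ContinuousOn (fun p : ℝ × E => (Δ (v p.1)) p.2) (Iio 0 ×ˢ univ))
    (heq : ∀ y, ∀ s t : ℝ, s ≤ t → t < 0 →
      v t y - v s y = ∫ τ in s..t, ((Δ (v τ)) y - fderiv ℝ (v τ) y (a τ y)))
    (hv0 : ∀ t < 0, ∀ y, 0 ≤ v t y) (hμ : 0 < μ) (hR : 0 < R) :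
    ∃ ε₀ > 0, ∀ t₁ < 0, ∀ y₁, μ < v t₁ y₁ →
      ∀ t ∈ Icc (t₁ + 1) (t₁ + 1 + R ^ 2), t < 0 → ∀ y, ‖y - y₁‖ < R → ε₀ ≤ v t y := by
  have hA : 0 ≤ A := (norm_nonneg _).trans (ha (-1) (by norm_num) 0)
  have hC : 0 ≤ C := (norm_nonneg _).trans (hbd (-1) (by norm_num) 0).1
  -- the constants of the barrier
  obtain ⟨d, hd⟩ : ∃ d : ℝ, d = (Module.finrank ℝ E : ℝ) := ⟨_, rfl⟩
  obtain ⟨r₀, hr₀def⟩ : ∃ r₀ : ℝ, r₀ = μ / (2 * (C + 1)) := ⟨_, rfl⟩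
  obtain ⟨κ, hκdef⟩ : ∃ κ : ℝ, κ = 2 * R := ⟨_, rfl⟩
  obtain ⟨ρmax, hρmaxdef⟩ : ∃ ρmax : ℝ, ρmax = r₀ + κ * (1 + R ^ 2) := ⟨_, rfl⟩
  obtain ⟨B, hB⟩ : ∃ B : ℝ, B = 2 * κ / r₀ + 2 * d / r₀ ^ 2 + 2 * A / r₀ := ⟨_, rfl⟩
  obtain ⟨n, hn⟩ : ∃ n : ℕ, n = ⌈B * ρmax ^ 2 / 4⌉₊ := ⟨_, rfl⟩
  obtain ⟨l, hl⟩ : ∃ l : ℝ, l = (n + 2) * B := ⟨_, rfl⟩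
  obtain ⟨m₀, hm₀⟩ : ∃ m₀ : ℝ, m₀ = μ / 2 := ⟨_, rfl⟩
  have hr₀ : 0 < r₀ := by rw [hr₀def]; positivity
  have hκ : 0 ≤ κ := by rw [hκdef]; positivity
  have hd0 : 0 ≤ d := by rw [hd]; positivity
  have hB0 : 0 ≤ B := by rw [hB]; positivity
  have hl0 : 0 ≤ l := by rw [hl]; positivity
  have hm₀0 : 0 < m₀ := by rw [hm₀]; positivity
  have hnB : B * ρmax ^ 2 ≤ 4 * (n + 1) := by
    have h1 : B * ρmax ^ 2 / 4 ≤ n := by rw [hn]; exact Nat.le_ceil _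
    linarith
  have hlB : (n + 2) * (2 * κ / r₀ + 2 * Module.finrank ℝ E / r₀ ^ 2 + 2 * A / r₀) ≤ l := by
    rw [hl, hB, hd]
  have hnB' : (2 * κ / r₀ + 2 * Module.finrank ℝ E / r₀ ^ 2 + 2 * A / r₀) * ρmax ^ 2 ≤
      4 * (n + 1) := by rwa [hB, hd] at hnB
  refine ⟨m₀ * Real.exp (-l * (1 + R ^ 2)) * (3 / 4) ^ (n + 2), by positivity, ?_⟩
  intro t₁ ht₁ y₁ hμ₁ t ht ht0 y hy
  -- abbreviations for the barrier data centred at `y₁`, started at `t₁`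
  have hrad : Continuous (knssRad r₀ κ t₁) := by
    have : knssRad r₀ κ t₁ = fun s => r₀ + κ * (s - t₁) := rfl
    rw [this]
    fun_prop
  have hrad_pos : ∀ s, t₁ ≤ s → 0 < knssRad r₀ κ t₁ s := fun s hs =>
    hr₀.trans_le (le_knssRad hκ hs)
  have hrad_t : knssRad r₀ κ t₁ t ≤ ρmax := by
    rw [hρmaxdef, knssRad]
    have : t - t₁ ≤ 1 + R ^ 2 := by linarith [ht.2]
    have := mul_le_mul_of_nonneg_left this hκ
    linarith
  -- hypotheses of the comparison principle
  have hφc : ContinuousOn (uncurry (knssBarrier y₁ m₀ l r₀ κ t₁ n)) (Icc t₁ t ×ˢ univ) := by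
    have e : uncurry (knssBarrier y₁ m₀ l r₀ κ t₁ n) = fun p : ℝ × E =>
        m₀ * Real.exp (-l * (p.1 - t₁)) *
          (1 - ‖p.2 - y₁‖ ^ 2 / knssRad r₀ κ t₁ p.1 ^ 2) ^ (n + 2) := by
      funext ⟨s, z⟩
      rfl
    rw [e]
    have h1 : Continuous fun p : ℝ × E => m₀ * Real.exp (-l * (p.1 - t₁)) := by fun_prop
    have h2 : Continuous fun p : ℝ × E => ‖p.2 - y₁‖ ^ 2 := by fun_prop
    have h3 : Continuous fun p : ℝ × E => knssRad r₀ κ t₁ p.1 ^ 2 :=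
      (hrad.comp continuous_fst).pow 2
    have h4 : ∀ p ∈ Icc t₁ t ×ˢ (univ : Set E), knssRad r₀ κ t₁ p.1 ^ 2 ≠ 0 :=
      fun p hp => pow_ne_zero 2 (hrad_pos p.1 hp.1.1).ne'
    exact h1.continuousOn.mul
      ((continuousOn_const.sub (h2.continuousOn.div h3.continuousOn h4)).pow _)
  have hφ2 : ∀ s ∈ Ioc t₁ t, ContDiff ℝ 2 (knssBarrier y₁ m₀ l r₀ κ t₁ n s) := by
    intro s _
    exact contDiff_knssBarrier y₁ m₀ l r₀ κ t₁ n s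
  have hφt : ∀ s ∈ Ioc t₁ t, ∀ z, ‖z - y₁‖ < knssRad r₀ κ t₁ s →
      HasDerivAt (fun s' => knssBarrier y₁ m₀ l r₀ κ t₁ n s' z)
        (knssBarrierDt y₁ m₀ l r₀ κ t₁ n s z) s := by
    intro s hs z _
    exact hasDerivAt_knssBarrier_time y₁ m₀ l r₀ κ t₁ n z (hrad_pos s hs.1.le).ne'
  have hsub : ∀ s ∈ Ioc t₁ t, ∀ z, ‖z - y₁‖ < knssRad r₀ κ t₁ s →
      knssBarrierDt y₁ m₀ l r₀ κ t₁ n s z - (Δ (knssBarrier y₁ m₀ l r₀ κ t₁ n s)) z +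
        A * ‖fderiv ℝ (knssBarrier y₁ m₀ l r₀ κ t₁ n s) z‖ ≤ 0 := by
    intro s hs z hz
    exact knssBarrier_subsolution hA hκ hr₀ hm₀0.le hlB hnB' hs.1.le
      ((knssRad_mono hκ hs.2).trans hrad_t) hz.le
  have hbot : ∀ z, ‖z - y₁‖ ≤ knssRad r₀ κ t₁ t₁ → knssBarrier y₁ m₀ l r₀ κ t₁ n t₁ z ≤ v t₁ z := by
    intro z hz
    have hrad₁ : knssRad r₀ κ t₁ t₁ = r₀ := by simp [knssRad]
    rw [hrad₁] at hz
    have hq1 : ‖z - y₁‖ ^ 2 / r₀ ^ 2 ≤ 1 := by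
      rw [div_le_one (by positivity)]
      exact pow_le_pow_left₀ (norm_nonneg _) hz 2
    have hq0 : 0 ≤ ‖z - y₁‖ ^ 2 / r₀ ^ 2 := by positivity
    have hφ : knssBarrier y₁ m₀ l r₀ κ t₁ n t₁ z ≤ m₀ := by
      have e : knssBarrier y₁ m₀ l r₀ κ t₁ n t₁ z = m₀ * (1 - ‖z - y₁‖ ^ 2 / r₀ ^ 2) ^ (n + 2) := by
        simp [knssBarrier, knssProfile, hrad₁]
      rw [e]
      have : (1 - ‖z - y₁‖ ^ 2 / r₀ ^ 2) ^ (n + 2) ≤ 1 := pow_le_one₀ (by linarith) (by linarith)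
      calc m₀ * (1 - ‖z - y₁‖ ^ 2 / r₀ ^ 2) ^ (n + 2) ≤ m₀ * 1 :=
          mul_le_mul_of_nonneg_left this hm₀0.le
        _ = m₀ := mul_one _
    have hv : m₀ ≤ v t₁ z := by
      have h1 := driftHeat_abs_sub_space_le ((hv2 t₁ ht₁).differentiable (by norm_num))
        (fun w => (hbd t₁ ht₁ w).1) z y₁
      have h2 : C * ‖z - y₁‖ ≤ μ / 2 := by
        have h3 : C * r₀ ≤ μ / 2 := by
          rw [hr₀def]
          rw [show C * (μ / (2 * (C + 1))) = μ / 2 * (C / (C + 1)) by field_simp]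
          have : C / (C + 1) ≤ 1 := by
            rw [div_le_one (by linarith)]
            linarith
          calc μ / 2 * (C / (C + 1)) ≤ μ / 2 * 1 := mul_le_mul_of_nonneg_left this (by linarith)
            _ = μ / 2 := mul_one _
        exact (mul_le_mul_of_nonneg_left hz hC).trans h3
      have h4 := (abs_le.1 (h1.trans h2)).1
      rw [hm₀]
      linarith
    exact hφ.trans hv
  have hlat : ∀ s ∈ Icc t₁ t, ∀ z, ‖z - y₁‖ = knssRad r₀ κ t₁ s →
      knssBarrier y₁ m₀ l r₀ κ t₁ n s z ≤ v s z := by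
    intro s hs z hz
    have hρ := hrad_pos s hs.1
    have e : knssBarrier y₁ m₀ l r₀ κ t₁ n s z = 0 := by
      rw [knssBarrier, knssProfile, hz, div_self (pow_ne_zero 2 hρ.ne'), sub_self,
        zero_pow (by positivity), mul_zero]
    rw [e]
    exact hv0 s (lt_of_le_of_lt hs.2 ht0) z
  -- the comparison principle on `[t₁, t]`
  have key : ∀ s ∈ Icc t₁ t, ∀ z, ‖z - y₁‖ ≤ knssRad r₀ κ t₁ s →
      knssBarrier y₁ m₀ l r₀ κ t₁ n s z ≤ v s z := by
    exact driftHeat_comparison (φ := knssBarrier y₁ m₀ l r₀ κ t₁ n)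
      (φₜ := knssBarrierDt y₁ m₀ l r₀ κ t₁ n) ht0 ha_meas ha hv2 hbd hcD hcΔ heq hrad hφc hφ2 hφt
      hsub hbot hlat
  -- evaluate the barrier at `(t, y)`
  have ht₁t : t₁ ≤ t := by linarith [ht.1]
  have hρt : 2 * R ≤ knssRad r₀ κ t₁ t := by
    rw [knssRad, hκdef]
    have : 1 ≤ t - t₁ := by linarith [ht.1]
    have := mul_le_mul_of_nonneg_left this (by positivity : (0 : ℝ) ≤ 2 * R)
    linarith
  have hyρ : ‖y - y₁‖ ≤ knssRad r₀ κ t₁ t := by linarith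
  have hle : knssBarrier y₁ m₀ l r₀ κ t₁ n t y ≤ v t y := by
    exact key t ⟨ht₁t, le_rfl⟩ y hyρ
  refine le_trans ?_ hle
  -- `ε₀ ≤ φ(t, y)`
  have hρ0 : 0 < knssRad r₀ κ t₁ t := hrad_pos t ht₁t
  have hq : ‖y - y₁‖ ^ 2 / knssRad r₀ κ t₁ t ^ 2 ≤ 1 / 4 := by
    rw [div_le_div_iff₀ (by positivity) (by norm_num : (0 : ℝ) < 4)]
    have h1 : ‖y - y₁‖ ^ 2 ≤ R ^ 2 := pow_le_pow_left₀ (norm_nonneg _) hy.le 2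
    have h2 : (2 * R) ^ 2 ≤ knssRad r₀ κ t₁ t ^ 2 := pow_le_pow_left₀ (by positivity) hρt 2
    calc ‖y - y₁‖ ^ 2 * 4 ≤ R ^ 2 * 4 := by gcongr
      _ = (2 * R) ^ 2 := by ring
      _ ≤ knssRad r₀ κ t₁ t ^ 2 := h2
      _ = 1 * knssRad r₀ κ t₁ t ^ 2 := (one_mul _).symm
  have hexp : Real.exp (-l * (1 + R ^ 2)) ≤ Real.exp (-l * (t - t₁)) := by
    apply Real.exp_le_exp.2
    have : t - t₁ ≤ 1 + R ^ 2 := by linarith [ht.2]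
    exact mul_le_mul_of_nonpos_left this (by linarith)
  have hpow : (3 / 4 : ℝ) ^ (n + 2) ≤ (1 - ‖y - y₁‖ ^ 2 / knssRad r₀ κ t₁ t ^ 2) ^ (n + 2) :=
    pow_le_pow_left₀ (by norm_num) (by linarith) _
  have e : knssBarrier y₁ m₀ l r₀ κ t₁ n t y =
      m₀ * Real.exp (-l * (t - t₁)) * (1 - ‖y - y₁‖ ^ 2 / knssRad r₀ κ t₁ t ^ 2) ^ (n + 2) := rfl
  rw [e]
  exact mul_le_mul (mul_le_mul_of_nonneg_left hexp hm₀0.le) hpow (by positivity) (by positivity)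

/-- **KNSS 2009, Lemma 2.1 in the half-ball form of §5 — proof of the named fact
`KNSS2009_lemma21_halfball`.** If `f` is a bounded solution of `fₜ + a·∇f − Δf = 0` on
`E × (−∞, 0)` in the elementary class of the fact, with `sup f = M₁ > 0` approached, then for
every `R > 0` some parabolic ball `B(y₀, R) × (t₀ − R², t₀)` has `f ≥ M₁/2`. Proof (elementary,
replacing KNSS's compactness argument): if not, every such ball contains a point where
`v = M₁ − f > M₁/2`; choosing it in `B(y*, R) × (t* − 1 − R², t* − 1)` and propagating
positivity (`driftHeat_propagation`) gives `v(t*, y*) ≥ ε₀` for *all* `(t*, y*)`, i.e.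
`f ≤ M₁ − ε₀`, contradicting `sup f = M₁`. [cite: KochNadirashviliSereginSverak2009, Lemma 2.1 (arXiv p. 5) and proofs of Thms 5.1–5.2 (pp. 9–10)] -/
theorem KNSS2009_lemma21_halfball_holds : KNSS2009_lemma21_halfball E := by
  intro f a A M₁ ha_meas ha _hf_bdd hf2 hder hcD hcΔ heq hM happ hM₁ R hR
  obtain ⟨C, hC⟩ := hder
  -- pass to `v = M₁ - f ≥ 0`, which lies in the same class
  set v : ℝ → E → ℝ := fun t y => M₁ - f t y with hv
  have hv2 : ∀ t < 0, ContDiff ℝ 2 (v t) := fun t ht => contDiff_const.sub (hf2 t ht)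
  have hvD : ∀ t < 0, ∀ y, fderiv ℝ (v t) y = -fderiv ℝ (f t) y := fun t _ y =>
    fderiv_const_sub M₁
  have hvΔ : ∀ t < 0, ∀ y, (Δ (v t)) y = -(Δ (f t)) y := by
    intro t ht y
    have h1 : v t = (fun _ : E => M₁) - f t := rfl
    rw [h1, contDiffAt_const.laplacian_sub (hf2 t ht).contDiffAt, laplacian_const]
    simp
  have hbd : ∀ t < 0, ∀ y, ‖fderiv ℝ (v t) y‖ ≤ C ∧ |(Δ (v t)) y| ≤ C := by
    intro t ht y
    rw [hvD t ht y, hvΔ t ht y, norm_neg, abs_neg]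
    exact hC t ht y
  have hcD' : ContinuousOn (fun p : ℝ × E => fderiv ℝ (v p.1) p.2) (Iio 0 ×ˢ univ) :=
    hcD.neg.congr fun p hp => hvD p.1 hp.1 p.2
  have hcΔ' : ContinuousOn (fun p : ℝ × E => (Δ (v p.1)) p.2) (Iio 0 ×ˢ univ) :=
    hcΔ.neg.congr fun p hp => hvΔ p.1 hp.1 p.2
  have heq' : ∀ y, ∀ s t : ℝ, s ≤ t → t < 0 →
      v t y - v s y = ∫ τ in s..t, ((Δ (v τ)) y - fderiv ℝ (v τ) y (a τ y)) := by
    intro y s t hst ht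
    have h1 : ∫ τ in s..t, ((Δ (v τ)) y - fderiv ℝ (v τ) y (a τ y)) =
        ∫ τ in s..t, -((Δ (f τ)) y - fderiv ℝ (f τ) y (a τ y)) := by
      refine intervalIntegral.integral_congr fun τ hτ => ?_
      rw [uIcc_of_le hst] at hτ
      have hτ0 : τ < 0 := lt_of_le_of_lt hτ.2 ht
      simp only [hvD τ hτ0, hvΔ τ hτ0, neg_apply]
      ring
    rw [h1, intervalIntegral.integral_neg, ← heq y s t hst ht]
    simp only [hv]
    ring
  have hv0 : ∀ t < 0, ∀ y, 0 ≤ v t y := fun t ht y => sub_nonneg.2 (hM t ht y)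
  -- propagation of positivity for `v`, with `μ = M₁ / 2`
  obtain ⟨ε₀, hε₀, hprop⟩ := driftHeat_propagation ha_meas ha hv2 hbd hcD' hcΔ' heq' hv0
    (half_pos hM₁) hR
  by_contra H
  push Not at H
  -- every parabolic ball of radius `R` contains a point with `f < M₁ / 2`; hence `f ≤ M₁ - ε₀`
  have hclaim : ∀ t < 0, ∀ y, f t y ≤ M₁ - ε₀ := by
    intro t ht y
    obtain ⟨t₁, ht₁, y₁, hy₁, hlt⟩ := H y (t - 1) (by linarith)
    have ht₁0 : t₁ < 0 := by linarith [ht₁.2]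
    have hμ : M₁ / 2 < v t₁ y₁ := by
      simp only [hv]
      linarith
    have hyy : ‖y - y₁‖ < R := by
      rw [← dist_eq_norm, dist_comm]
      exact hy₁
    have := hprop t₁ ht₁0 y₁ hμ t ⟨by linarith [ht₁.2], by linarith [ht₁.1]⟩ ht y hyy
    simp only [hv] at this
    linarith
  obtain ⟨t, ht, y, hy⟩ := happ ε₀ hε₀
  linarith [hclaim t ht y]

end Propagation

end Literature.Analysis.FluidPDE

end
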